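import Summits.Ventures.CertifiedManyBodySolver.Rows.CorrWindowCertKernelChainQuotAdj
import HarnessLib

/-!
# A DROP-IN FAST EDITION of the chain step: `stepEQAF D B C T H = stepEQA D B C T H` (same function, fewer kernel steps)

The engine's `wordToPoly` (CQC `Rows/CARNormalOrder.lean`) on a word of the shape `Mono.word m` (creators before annihilators)
never takes a contraction branch: it is a signed insertion of each half. `monoNF` computes exactly that with a `Bool` parity
instead of `ℚ` products, and `wordToPoly_word : wordToPoly (Mono.word m) = monoNF m` holds for EVERY `m` (sorted or not,
repeated letters included — then both sides are `[]`). The step's re-normalisations of such words (`hintTgt`, the zero-class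
test, the adjoint target, the `normalize` passes after `quotOutZ` / `adjOut`) are routed through it; `stepEQAF_eq` is an
unconditional function equation (no geometry, no data, no `Decidable` trick), so a chain file keeps its statement
`C' = stepEQA D B C T H` and proves it by `stepEQAF_kernel (by decide +kernel)`. The box-geometry edition with closed-form
letter maps (the measured lever) is `Rows/CorrWindowCertKernelChainQuotAdjFastBox.lean`.

HONEST FRAMING (xx1): Lean plumbing towards «tier P» — a PROOF-TERM-only speed-up of the kernel replay of chain steps; every
`step_s` statement, every accumulator literal, every census/EQUAL artefact, `ChainQAOK`/`StepsQA`/Assembly/closer stays byte-identical.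
Nothing of record moves; no certificate is evaluated here; no claim node is discharged; CONTROL/CALIBRATION context; silent on the
presence of superconductivity; not a `T_c` or phase sentence; nothing about any material; no summit statement is proved by this file.
Cell `hubbard-obs` × `hubbard-downfold` (D-0154 (1)(C) La214), seat hubbard-cov-la214-box-2 g5 (`prover-hubbard-cov-la214-box-2-g5-0`),
lever (L7) of captain ruling R-g4-12 (obs-p2 GO 2026-08-29T02:25:48Z), zero compute.

References: C. Jansson, D. Chaykin, C. Keil, SIAM J. Numer. Anal. 46 (2008) 180 [JanssonChaykinKeil2008]; X. Han, arXiv:2006.06002 §3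
[Han2020Bootstrap]; O. Bratteli, D. W. Robinson, *Operator Algebras and Quantum Statistical Mechanics 2* §5.2.2 [BratteliRobinsonII1997].
-/

namespace Summit.Ventures.CertifiedManyBodySolver

namespace CARPolyWindow

open Summit.Ventures.CertifiedQuantumChemistry Summit.Ventures.CertifiedQuantumChemistry.CARPoly
open Literature.MathematicalPhysics.QuantumLattice Literature.MathematicalPhysics.QuantumLattice.HubbardWave0

/-! ## §1 Signed insertion: the engine on `Mono.word`-shaped words -/

section MonoNF

variable {α : Type*} [LinearOrder α]

/-- The sign of a parity bit as a rational. [folklore] -/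
def sgnQ (s : Bool) : ℚ := if s then -1 else 1

/-- Signed insertion of `x` into a list: `none` if `x` occurs, else the list with `x` inserted before the first larger element and
the parity of the number of elements passed. [folklore] -/
def insS (x : α) : List α → Option (List α × Bool)
  | [] => some ([x], false)
  | a :: A => if x < a then some (x :: a :: A, false) else if x = a then none else
      match insS x A with
      | none => none
      | some ls => some (a :: ls.1, !ls.2)

/-- Signed insertion sort from the right: `none` on a repeated letter, else the sorted list and the parity of the permutation.
[folklore] -/
def sortS : List α → Option (List α × Bool)
  | [] => some ([], false)
  | x :: xs =>
    match sortS xs with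
    | none => none
    | some ls =>
      match insS x ls.1 with
      | none => none
      | some ls' => some (ls'.1, xor ls.2 ls'.2)

/-- **The engine's normal form of a creator-then-annihilator word, computed by signed insertion.** [cite: BratteliRobinsonII1997, §5.2.2] -/
def monoNF (m : CARPoly.Mono α) : CARPoly.Poly α :=
  match sortS m.1, sortS m.2 with
  | some lc, some la => [((lc.1, la.1), sgnQ (xor lc.2 la.2))]
  | _, _ => []

omit [LinearOrder α] in
/-- Flipping the parity flips the sign. [folklore] -/
theorem sgnQ_not (s : Bool) : sgnQ (!s) = -sgnQ s := by cases s <;> simp [sgnQ]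

omit [LinearOrder α] in
/-- Parities compose multiplicatively. [folklore] -/
theorem sgnQ_xor (s t : Bool) : sgnQ (xor s t) = sgnQ s * sgnQ t := by cases s <;> cases t <;> simp [sgnQ]

omit [LinearOrder α] in
/-- A sign is never zero. [folklore] -/
theorem sgnQ_ne_zero (s : Bool) : sgnQ s ≠ 0 := by cases s <;> simp [sgnQ]

/-- `insAnn` is signed insertion. [folklore] -/
theorem insAnn_eq (x : α) : ∀ A : List α,
    CARPoly.insAnn x A = (match insS x A with | none => [] | some ls => [(([], ls.1), sgnQ ls.2)])
  | [] => by simp [CARPoly.insAnn, insS, sgnQ]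
  | a :: A => by
    rw [CARPoly.insAnn, insS]
    by_cases h1 : x < a
    · simp [h1, sgnQ]
    · by_cases h2 : x = a
      · simp [h2]
      · simp only [h1, h2, if_false]
        rw [insAnn_eq x A]
        cases insS x A with
        | none => rfl
        | some ls => simp [sgnQ_not]

/-- `prependCre` is signed insertion. [folklore] -/
theorem prependCre_eq (x : α) (B : List α) : ∀ C : List α,
    CARPoly.prependCre x C B = (match insS x C with | none => [] | some ls => [((ls.1, B), sgnQ ls.2)])
  | [] => by simp [CARPoly.prependCre, insS, sgnQ]
  | c :: C => by
    rw [CARPoly.prependCre, insS]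
    by_cases h1 : x < c
    · simp [h1, sgnQ]
    · by_cases h2 : x = c
      · simp [h2]
      · simp only [h1, h2, if_false]
        rw [prependCre_eq x B C]
        cases insS x C with
        | none => rfl
        | some ls => simp [sgnQ_not]

/-- The annihilator phase of `wordToPoly`. [folklore] -/
theorem wordToPoly_anns : ∀ as : List α,
    CARPoly.wordToPoly (as.map fun a => (a, false)) =
      (match sortS as with | none => [] | some ls => [(([], ls.1), sgnQ ls.2)])
  | [] => by simp [CARPoly.wordToPoly, sortS, sgnQ, CARPoly.Mono.unit]
  | x :: xs => by
    rw [List.map_cons, CARPoly.wordToPoly, wordToPoly_anns xs, sortS]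
    cases sortS xs with
    | none => simp [CARPoly.prependLetterPoly]
    | some ls =>
      simp only [CARPoly.prependLetterPoly, List.flatMap_cons, List.flatMap_nil, List.append_nil, CARPoly.prependLetter,
        CARPoly.prependAnn, Bool.false_eq_true, if_false]
      rw [insAnn_eq]
      cases insS x ls.1 with
      | none => rfl
      | some ls' => simp [sgnQ_xor]

/-- **`wordToPoly` of a creator-then-annihilator word is `monoNF`** (no hypothesis on the letters). [cite: BratteliRobinsonII1997, §5.2.2] -/
theorem wordToPoly_word (m : CARPoly.Mono α) : CARPoly.wordToPoly (CARPoly.Mono.word m) = monoNF m := by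
  obtain ⟨cs, as⟩ := m
  unfold CARPoly.Mono.word monoNF
  dsimp only
  induction cs with
  | nil =>
    rw [List.map_nil, List.nil_append, wordToPoly_anns, sortS]
    cases sortS as with
    | none => rfl
    | some la => simp
  | cons c cs ih =>
    rw [List.map_cons, List.cons_append, CARPoly.wordToPoly, ih, sortS]
    cases hcs : sortS cs with
    | none => simp [CARPoly.prependLetterPoly]
    | some lc =>
      cases has : sortS as with
      | none =>
        simp only [CARPoly.prependLetterPoly, List.flatMap_nil]
        cases insS c lc.1 <;> rfl
      | some la =>
        simp only [CARPoly.prependLetterPoly, List.flatMap_cons, List.flatMap_nil, List.append_nil, CARPoly.prependLetter,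
          if_true]
        rw [prependCre_eq]
        cases insS c lc.1 with
        | none => rfl
        | some lc' =>
          simp only [List.map_cons, List.map_nil]
          congr 2
          rw [← sgnQ_xor]; congr 1
          cases lc.2 <;> cases lc'.2 <;> cases la.2 <;> rfl

end MonoNF

/-! ## §2 Normal form of `Mono.word`-shaped term lists -/

section NormM

variable {α : Type*} [LinearOrder α]

/-- `termsToPoly` for lists of (monomial, coefficient) whose words are `Mono.word m`, via `monoNF`. [folklore] -/
def termsToPolyM (TM : List (CARPoly.Mono α × ℚ)) : CARPoly.Poly α :=
  TM.flatMap fun mc => (monoNF mc.1).map fun mq => (mq.1, mc.2 * mq.2)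

/-- `normalize` of such a list. [folklore] -/
def normalizeM (enc : α → ℕ) (B : ℕ) (TM : List (CARPoly.Mono α × ℚ)) : CARPoly.Poly α := CARPoly.collect enc B (termsToPolyM TM)

/-- The word form of a (monomial, coefficient) list. [folklore] -/
def wordsOf (TM : List (CARPoly.Mono α × ℚ)) : List (List (α × Bool) × ℚ) := TM.map fun mc => (CARPoly.Mono.word mc.1, mc.2)

/-- `termsToPoly` of `Mono.word`-shaped terms is `termsToPolyM`. [folklore] -/
theorem termsToPoly_wordsOf (TM : List (CARPoly.Mono α × ℚ)) : CARPoly.termsToPoly (wordsOf TM) = termsToPolyM TM := by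
  induction TM with
  | nil => rfl
  | cons mc TM ih =>
    simp only [wordsOf, List.map_cons, CARPoly.termsToPoly, List.flatMap_cons, termsToPolyM] at ih ⊢
    rw [wordToPoly_word, ih]

/-- **`normalize` of `Mono.word`-shaped terms is `normalizeM`.** [folklore] -/
theorem normalize_wordsOf (enc : α → ℕ) (B : ℕ) (TM : List (CARPoly.Mono α × ℚ)) :
    CARPoly.normalize enc B (wordsOf TM) = normalizeM enc B TM := by
  rw [CARPoly.normalize, termsToPoly_wordsOf, normalizeM]

omit [LinearOrder α] in
/-- The dagger of a `Mono.word` is the `Mono.word` of the swapped, reversed halves. [cite: BratteliRobinsonII1997, §5.2.2] -/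
theorem daggerW_word (m : CARPoly.Mono α) : daggerW (CARPoly.Mono.word m) = CARPoly.Mono.word (m.2.reverse, m.1.reverse) := by
  obtain ⟨cs, as⟩ := m
  simp [daggerW, CARPoly.Mono.word, List.map_reverse, Function.comp_def]

end NormM

/-! ## §3 The fast step (generic geometry) -/

section FastStep

variable {N Nβ : ℕ}

/-- Fast `hintTgt`. [cite: Han2020Bootstrap, §3] -/
def hintTgtF (D : QuotData N Nβ) (B : ℕ) (h : QHint Nβ) : CARPoly.Poly (Orb (Fin N)) :=
  normalizeM SOSDual.encL B [(mapMono (gq D (d4OfCode h.γ) (siteOfPair h.v)) h.μ, 1)]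

/-- `hintTgtF` IS `hintTgt`. [folklore] -/
theorem hintTgtF_eq (D : QuotData N Nβ) (B : ℕ) (h : QHint Nβ) : hintTgtF D B h = hintTgt D B h := by
  rw [hintTgt, hintTgtF, ← normalize_wordsOf]; rfl

/-- Fast `hintRows`. [folklore] -/
def hintRowsF (D : QuotData N Nβ) (B : ℕ) (H : List (QHint Nβ)) : List (HRow N Nβ) :=
  H.filterMap fun h =>
    if D.ok h.γ h.v then
      match hintTgtF D B h with
      | [(m, ε)] => some (CARPoly.Mono.key SOSDual.encL B m, (m, (ε, h)))
      | _ => none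
    else none

/-- `hintRowsF` IS `hintRows`. [folklore] -/
theorem hintRowsF_eq (D : QuotData N Nβ) (B : ℕ) (H : List (QHint Nβ)) : hintRowsF D B H = hintRows D B H := by
  induction H with
  | nil => rfl
  | cons h H ih =>
    simp only [hintRowsF, hintRows, List.filterMap_cons] at ih ⊢
    rw [ih, hintTgtF_eq]
    rcases hh : hintTgt D B h with _ | ⟨⟨m, ε⟩, _ | ⟨b, l⟩⟩ <;> rfl

/-- Fast `rowOK`. [folklore] -/
def rowOKF (D : QuotData N Nβ) (B : ℕ) (m : CARPoly.Mono (Orb (Fin N))) (r : HRow N Nβ) : Bool :=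
  decide (r.2.1 = m) && D.ok r.2.2.2.γ r.2.2.2.v && !decide (r.2.2.1 = 0) && decide (hintTgtF D B r.2.2.2 = [(m, r.2.2.1)])

/-- `rowOKF` IS `rowOK`. [folklore] -/
theorem rowOKF_eq (D : QuotData N Nβ) (B : ℕ) (m : CARPoly.Mono (Orb (Fin N))) (r : HRow N Nβ) : rowOKF D B m r = rowOK D B m r := by
  simp only [rowOKF, rowOK, hintTgtF_eq]

/-- Fast `annotate`. [folklore] -/
def annotateF (D : QuotData N Nβ) (B : ℕ) : CARPoly.Poly (Orb (Fin N)) → List (HRow N Nβ) → List (ATerm N Nβ)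
  | [], _ => []
  | t :: P, R =>
    match dropBehind (CARPoly.Mono.key SOSDual.encL B t.1) R with
    | [] => (t, none) :: annotateF D B P []
    | r :: R' => if rowOKF D B t.1 r then (t, some r.2.2) :: annotateF D B P R' else (t, none) :: annotateF D B P (r :: R')

/-- `annotateF` IS `annotate`. [folklore] -/
theorem annotateF_eq (D : QuotData N Nβ) (B : ℕ) : ∀ (P : CARPoly.Poly (Orb (Fin N))) (R : List (HRow N Nβ)),
    annotateF D B P R = annotate D B P R
  | [], R => by rw [annotateF, annotate]
  | t :: P, R => by
    rw [annotateF, annotate]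
    cases dropBehind (CARPoly.Mono.key SOSDual.encL B t.1) R with
    | nil => simp only [annotateF_eq D B P []]
    | cons r R' =>
      simp only [rowOKF_eq, annotateF_eq D B P R', annotateF_eq D B P (r :: R')]

/-- Fast zero-class test. [cite: Han2020Bootstrap, §3] -/
def zeroQF (D : QuotData N Nβ) (B : ℕ) (m : CARPoly.Mono (Orb (Fin N))) (e : ℚ × QHint Nβ) : Bool :=
  decide (e.1 = -1) && decide (normalizeM SOSDual.encL B [(mapMono D.f e.2.μ, 1)] = [(m, 1)])

/-- `zeroQF` IS `zeroQ`. [folklore] -/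
theorem zeroQF_eq (D : QuotData N Nβ) (B : ℕ) (m : CARPoly.Mono (Orb (Fin N))) (e : ℚ × QHint Nβ) : zeroQF D B m e = zeroQ D B m e := by
  rw [zeroQF, zeroQ, ← normalize_wordsOf]; rfl

/-- The quotiented term list as (monomial, coefficient) pairs. [cite: Han2020Bootstrap, §3] -/
def quotOutZM (D : QuotData N Nβ) (B : ℕ) (A : List (ATerm N Nβ)) : List (CARPoly.Mono (Orb (Fin N)) × ℚ) :=
  A.flatMap fun a => match a.2 with
    | none => [(a.1.1, a.1.2)]
    | some e => if zeroQF D B a.1.1 e then [] else [(mapMono D.f e.2.μ, a.1.2 / e.1)]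

/-- The word form of `quotOutZM` IS `quotOutZ`. [folklore] -/
theorem wordsOf_quotOutZM (D : QuotData N Nβ) (B : ℕ) (A : List (ATerm N Nβ)) : wordsOf (quotOutZM D B A) = quotOutZ D B A := by
  induction A with
  | nil => rfl
  | cons a A ih =>
    simp only [quotOutZM, quotOutZ, List.flatMap_cons, wordsOf, List.map_append] at ih ⊢
    rw [ih]
    congr 1
    rcases a with ⟨⟨m, c⟩, _ | e⟩
    · rfl
    · simp only [zeroQF_eq]
      split <;> rfl

/-- Fast adjoint target. [cite: BratteliRobinsonII1997, §5.2.2] -/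
def adjTgtF (B : ℕ) (m : CARPoly.Mono (Orb (Fin N))) : CARPoly.Poly (Orb (Fin N)) :=
  normalizeM SOSDual.encL B [((m.2.reverse, m.1.reverse), 1)]

/-- `adjTgtF` IS `adjTgt`. [folklore] -/
theorem adjTgtF_eq (B : ℕ) (m : CARPoly.Mono (Orb (Fin N))) : adjTgtF B m = adjTgt B m := by
  rw [adjTgt, adjTgtF, daggerW_word, ← normalize_wordsOf]; rfl

/-- Fast `adjTerm`, emitting a (monomial, coefficient) pair. [cite: Han2020Bootstrap, §3] -/
def adjTermM (B : ℕ) (t : CARPoly.Mono (Orb (Fin N)) × ℚ) :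
    (CARPoly.Mono (Orb (Fin N)) × ℚ) × Option (Terms (Orb (Fin N))) :=
  match adjTgtF B t.1 with
  | [(m', ε)] =>
    if CARPoly.Mono.key SOSDual.encL B m' < CARPoly.Mono.key SOSDual.encL B t.1 then ((m', ε * t.2), some [(CARPoly.Mono.word t.1, -t.2)])
    else ((t.1, t.2), none)
  | _ => ((t.1, t.2), none)

/-- `adjTerm` in terms of `adjTermM`. [folklore] -/
theorem adjTerm_eq (B : ℕ) (t : CARPoly.Mono (Orb (Fin N)) × ℚ) :
    adjTerm B t = ((CARPoly.Mono.word (adjTermM B t).1.1, (adjTermM B t).1.2), (adjTermM B t).2) := by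
  rcases hh : adjTgt B t.1 with _ | ⟨⟨m', ε⟩, _ | ⟨b, l⟩⟩
  · simp only [adjTerm, adjTermM, adjTgtF_eq, hh]
  · simp only [adjTerm, adjTermM, adjTgtF_eq, hh]
    split_ifs <;> rfl
  · simp only [adjTerm, adjTermM, adjTgtF_eq, hh]

/-- Fast `adjOut`, as (monomial, coefficient) pairs. [folklore] -/
def adjOutM (B : ℕ) (P : CARPoly.Poly (Orb (Fin N))) : List (CARPoly.Mono (Orb (Fin N)) × ℚ) := P.map fun t => (adjTermM B t).1

/-- The word form of `adjOutM` IS `adjOut`. [folklore] -/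
theorem wordsOf_adjOutM (B : ℕ) (P : CARPoly.Poly (Orb (Fin N))) : wordsOf (adjOutM B P) = adjOut B P := by
  simp only [wordsOf, adjOutM, adjOut, List.map_map]
  congr 1
  funext t
  simp only [Function.comp, adjTerm_eq]

/-- **The fast step** (same value as `stepEQA`, see `stepEQAF_eq`). [cite: JanssonChaykinKeil2008, §3] [cite: Han2020Bootstrap, §3] -/
def stepEQAF (D : QuotData N Nβ) (B : ℕ) (C : SOSDual.EncPoly) (T : Terms (Orb (Fin N))) (H : List (QHint Nβ)) : SOSDual.EncPoly :=
  let A := annotateF D B (CARPoly.normalize SOSDual.encL B T) (sortByKey (hintRowsF D B H))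
  let P1 := normalizeM SOSDual.encL B (quotOutZM D B A)
  SOSDual.mergeE B C (SOSDual.encPoly (normalizeM SOSDual.encL B (adjOutM B P1)))

/-- **The fast step IS the step.** [folklore] -/
theorem stepEQAF_eq (D : QuotData N Nβ) (B : ℕ) (C : SOSDual.EncPoly) (T : Terms (Orb (Fin N))) (H : List (QHint Nβ)) :
    stepEQAF D B C T H = stepEQA D B C T H := by
  rw [stepEQAF, stepEQA, adjSlice, quotSliceZ, annSlice]
  rw [annotateF_eq, hintRowsF_eq, ← normalize_wordsOf, wordsOf_adjOutM, ← normalize_wordsOf, wordsOf_quotOutZM]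

/-- Chain-file entry point for the generic fast step: `theorem step_s : C' = stepEQA D B C T H := stepEQAF_kernel (by decide +kernel)`.
[folklore] -/
theorem stepEQAF_kernel {D : QuotData N Nβ} {B : ℕ} {C C' : SOSDual.EncPoly} {T : Terms (Orb (Fin N))} {H : List (QHint Nβ)}
    (h : (C' == stepEQAF D B C T H) = true) : C' = stepEQA D B C T H :=
  (eq_of_beq h).trans (stepEQAF_eq D B C T H)

end FastStep

end CARPolyWindow

end Summit.Ventures.CertifiedManyBodySolver
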